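import Literature.NumberTheory.EllipticCurves.HeegnerPointsKolyvaginSplitDescentProofs
import HarnessLib

/-!
# Kolyvagin's bound on the order of `Ш`: the Cassels–Tate telescope in SPLIT form (any prime `p`)

Split-form twin (`KolyvaginDescent.SplitHypothesesM`: two eigengroups `V^{±} ≤ V` instead of an
involution, no parity hypothesis on `p`; sibling `HeegnerPointsKolyvaginSplitDescentProofs`) of
`HeegnerPointsKolyvaginPrimaryOrderTelescopeProofs` (the same theorem for the `τ`-form data
`HypothesesM`, `p` odd): McCallum 1991, §1 Theorem with Thm. 5.4 "≤" and Cor. 5.6 in TELESCOPE form,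
**`∑ᵢ Nᵢ ≤ M₀`**. The `τ`-form proof uses the involution only as a TAG (which eigenspace a class lies
in) handed to its two displayed inputs — the Cassels–Tate value formula `hCTV` (Prop. 4.7 with
Lemma 5.3 and Prop. 4.4, order language) and Čebotarev in kernel form `hCeb` (Prop. 3.1) — so it
transposes VERBATIM to the split form, with "`τ t = e t`" read as "`t ∈ V^{e}`"; this file is that
transposition (proof text of the sibling, McCallum's induction (16)–(23) run with the invariant (I),
no Prop. 5.2). Reading at `p = 2` (pair `(E, E^{(d_K)})` over `ℚ`, `V = H¹(ℚ, E^{ε}[2^M]) × H¹(ℚ, E^{-ε}[2^M])`,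
`P` = the two Cassels–Tate pairings): for lifts `s₁, s₂, …` of generators of maximal isotropic
subgroups of `Ш(E^{-ε}/ℚ)_{2^∞}` (odd positions) and `Ш(E^{ε}/ℚ)_{2^∞}` (even positions),
`∑ Nᵢ ≤ M₀`, whence `#Ш(E/ℚ)_{2^∞} · #Ш(E^{(d_K)}/ℚ)_{2^∞} ≤ 4^{M₀}` once the two symplectic counts
are made (McCallum p. 312; the `τ`-form count is `HeegnerPointsKolyvaginPrimaryOrderProofs`).

* `SplitHypothesesM.exists_chain_of_casselsTate` — the chain `n_k = ℓ₁⋯ℓ_k` with invariant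
  **(I)** `p^i c(n_k) ∈ ⟨s_j : j > k⟩ ⟹ i ≥ (M − M₀) + N₁ + ⋯ + N_k`;
* `SplitHypothesesM.sum_expo_le_M₀_of_casselsTate` — **`∑ᵢ expo sᵢ ≤ M₀`**.

Inputs at `2` for the pair (NOT supplied here): `hCTV` from the tree's Cassels–Tate files
(`CasselsTateSelmerKolyvaginValue`: the pulled-back value on a Kolyvagin pair reduces to the term at
`λ`) over `ℚ` for each member, with McCallum's Lemma 5.3 over `ℚ_ℓ` (CYCLIC local groups of order
`2^M` on `Δ(E) < 0`, no defect); `hCeb` = Prop. 3.1 in kernel form at `2` for eigenclasses of both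
signs (the tree's `McCallum1991_prop_3_1_kernel_of_chebotarev` is `p ≠ 2`; its signed Step B at `2`
is `GenusExact.exists_h1Eval_conj_mul_order_signStable` of the BSD route `GenusKolyvaginAtTwo`).
No definition, no named fact; nothing here is a claim about BSD.

## References

* W. G. McCallum, *Kolyvagin's work on Shafarevich–Tate groups*, in *`L`-functions and
  arithmetic (Durham, 1989)*, LMS Lecture Note Ser. 153, CUP (1991), 295–316: §1 Theorem, §3
  Prop. 3.1 / Cor. 3.2, §4 Prop. 4.4, Lemma 4.6, Prop. 4.7, §5 Lemma 5.1, Lemma 5.3, Thm. 5.4 and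
  its proof ((16)–(23)), Cor. 5.6 (held `book:editornd-l-functions-arithmetic`, PDF pp. 280,
  283–290). [McCallumLMS1991]
* V. A. Kolyvagin, Izv. 1989, §3 (the pair `(E, E^D)` over `ℚ` at `l = 2`). [Kolyvagin1989Izv]
-/

open scoped Classical

namespace Literature.NumberTheory.EllipticCurves

namespace KolyvaginDescent

namespace SplitHypothesesM

variable {V : Type*} [AddCommGroup V] {Pl : Type*} (S : SplitHypothesesM V Pl)

/-! ### Plumbing (the sibling's order lemmas, restated for this file) -/

/-- `x` has order exactly `p^M`: `k • x = 0 ↔ p^M ∣ k`. [folklore] -/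
private theorem zsmul_x_eq_zero_iff' (k : ℤ) : k • S.x = 0 ↔ ((S.p : ℤ) ^ S.M) ∣ k :=
  zsmul_eq_zero_iff_prime_pow_dvd S.hp (S.torsion S.x) S.x_ord k

/-- `p^{expo s} • s = 0`. [folklore] -/
private theorem pow_expo_zsmul' (s : V) : ((S.p : ℤ) ^ S.expo s) • s = 0 := by
  have h : ∃ a : ℕ, ((S.p : ℤ) ^ a) • s = 0 := ⟨S.M, S.torsion s⟩
  exact Nat.find_spec h

/-- `p^{expo s - 1} • s ≠ 0` when `expo s ≠ 0`. [folklore] -/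
private theorem pow_expo_sub_one_zsmul_ne_zero' {s : V} (h : S.expo s ≠ 0) :
    ((S.p : ℤ) ^ (S.expo s - 1)) • s ≠ 0 := by
  have h' : ∃ a : ℕ, ((S.p : ℤ) ^ a) • s = 0 := ⟨S.M, S.torsion s⟩
  have hlt : S.expo s - 1 < Nat.find h' := Nat.sub_one_lt h
  exact Nat.find_min h' hlt

/-! ### Square-free products with one more Kolyvagin prime -/

/-- `ℓ n ∈ S_{r+1}` for `n ∈ S_r` and a Kolyvagin prime `ℓ ∤ n`. [folklore] -/
private theorem kolSupp_mul_of_not_dvd {ℓ n : ℕ} (hℓ : S.Kol ℓ) (hn : KolSupp S.Kol n) (hℓn : ¬ ℓ ∣ n) :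
    KolSupp S.Kol (ℓ * n) := by
  have hℓp := S.prime_of_kol ℓ hℓ
  refine ⟨?_, fun q hq ↦ ?_⟩
  · rw [Nat.squarefree_mul_iff]
    exact ⟨(Nat.Prime.coprime_iff_not_dvd hℓp).mpr hℓn, hℓp.squarefree, hn.1⟩
  · rw [Nat.primeFactors_mul hℓp.ne_zero hn.1.ne_zero, Finset.mem_union, hℓp.primeFactors,
      Finset.mem_singleton] at hq
    rcases hq with rfl | hq
    · exact hℓ
    · exact hn.2 q hq

/-- `ℓ n` has one more prime factor than `n` (`ℓ ∤ n`). [folklore] -/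
private theorem card_primeFactors_mul_of_not_dvd {ℓ n : ℕ} (hℓ : ℓ.Prime) (hn : n ≠ 0) (hℓn : ¬ ℓ ∣ n) :
    (ℓ * n).primeFactors.card = n.primeFactors.card + 1 := by
  rw [Nat.primeFactors_mul hℓ.ne_zero hn, hℓ.primeFactors, ← Finset.insert_eq,
    Finset.card_insert_of_notMem fun h ↦ hℓn (Nat.dvd_of_mem_primeFactors h)]

/-- The signs `ε_i = ε (-1)^i` are `±1`. [folklore] -/
private theorem sign_pow_cases (i : ℕ) : S.ε * (-1) ^ i = 1 ∨ S.ε * (-1) ^ i = -1 := by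
  rcases S.hε with h | h <;> rcases neg_one_pow_eq_or ℤ i with h' | h' <;> simp [h, h']

/-! ### Elements of the span of finitely many members of a family -/

/-- An element of the subgroup generated by `{s i : i ∈ I}` is a `ℤ`-combination of the `s i`.
[folklore] -/
private theorem exists_sum_of_mem_closure_image (s : ℕ → V) (I : Finset ℕ) {v : V}
    (hv : v ∈ AddSubgroup.closure ((I.image s : Finset V) : Set V)) :
    ∃ a : ℕ → ℤ, v = ∑ i ∈ I, a i • s i := by
  induction hv using AddSubgroup.closure_induction with
  | mem w hw =>
    rw [Finset.coe_image, Set.mem_image] at hw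
    obtain ⟨i, hi, rfl⟩ := hw
    rw [Finset.mem_coe] at hi
    refine ⟨fun j ↦ if j = i then 1 else 0, ?_⟩
    simp only [ite_smul, one_smul, zero_smul, Finset.sum_ite_eq', hi, if_true]
  | zero => exact ⟨0, by simp⟩
  | add w w' _ _ hw hw' =>
    obtain ⟨a, rfl⟩ := hw
    obtain ⟨a', rfl⟩ := hw'
    exact ⟨a + a', by simp only [Pi.add_apply, add_smul, Finset.sum_add_distrib]⟩
  | neg w _ hw =>
    obtain ⟨a, rfl⟩ := hw
    exact ⟨-a, by simp only [Pi.neg_apply, neg_smul, Finset.sum_neg_distrib]⟩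

/-- Independence of `x, s₁, …, s_K` as a flag condition: `a s_k ∈ ⟨s_j : k < j ≤ K⟩ ⟹ a s_k = 0`.
[folklore] -/
private theorem zsmul_eq_zero_of_mem_closure_Ioc {K : ℕ} {s : ℕ → V}
    (hind : ∀ (b : ℤ) (a : ℕ → ℤ), b • S.x + ∑ i ∈ Finset.Ioc 0 K, a i • s i = 0 →
      b • S.x = 0 ∧ ∀ i ∈ Finset.Ioc 0 K, a i • s i = 0)
    {k : ℕ} (hk : k ∈ Finset.Ioc 0 K) {a : ℤ}
    (h : a • s k ∈ AddSubgroup.closure (((Finset.Ioc k K).image s : Finset V) : Set V)) :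
    a • s k = 0 := by
  obtain ⟨c, hc⟩ := exists_sum_of_mem_closure_image s _ h
  have hkk : k ∉ Finset.Ioc k K := by simp
  have hsub : Finset.Ioc 0 K ∩ Finset.Ioc k K = Finset.Ioc k K := by
    apply Finset.inter_eq_right.mpr
    intro i hi
    simp only [Finset.mem_Ioc] at hi hk ⊢
    omega
  set a' : ℕ → ℤ := fun i ↦ (if i = k then a else 0) + (if i ∈ Finset.Ioc k K then -c i else 0)
    with ha'
  have hrel : (0 : ℤ) • S.x + ∑ i ∈ Finset.Ioc 0 K, a' i • s i = 0 := by
    have h1 : ∀ i, a' i • s i =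
        (if i = k then a • s i else 0) + (if i ∈ Finset.Ioc k K then (-c i) • s i else 0) := by
      intro i
      simp only [ha', add_smul, ite_smul, zero_smul]
    simp only [zero_smul, zero_add, h1, Finset.sum_add_distrib, Finset.sum_ite_eq', hk, if_true,
      Finset.sum_ite_mem, hsub, neg_smul, Finset.sum_neg_distrib, ← hc, add_neg_cancel]
  have := (hind 0 a' hrel).2 k hk
  simpa [ha', hkk] using this

/-- Independence of `x, s₁, …, s_K` as a flag condition at `x`: `b x ∈ ⟨s_j : 0 < j ≤ K⟩ ⟹ b x = 0`.
[folklore] -/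
private theorem zsmul_x_eq_zero_of_mem_closure_Ioc {K : ℕ} {s : ℕ → V}
    (hind : ∀ (b : ℤ) (a : ℕ → ℤ), b • S.x + ∑ i ∈ Finset.Ioc 0 K, a i • s i = 0 →
      b • S.x = 0 ∧ ∀ i ∈ Finset.Ioc 0 K, a i • s i = 0)
    {b : ℤ} (h : b • S.x ∈ AddSubgroup.closure (((Finset.Ioc 0 K).image s : Finset V) : Set V)) :
    b • S.x = 0 := by
  obtain ⟨c, hc⟩ := exists_sum_of_mem_closure_image s _ h
  have hrel : b • S.x + ∑ i ∈ Finset.Ioc 0 K, (-c i) • s i = 0 := by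
    simp only [neg_smul, Finset.sum_neg_distrib, ← hc, add_neg_cancel]
  exact (hind b (fun i ↦ -c i) hrel).1

/-! ### Isotropy along a span -/

/-- If `t` pairs to zero with every member of `T ⊆ Sel`, it pairs to zero with `⟨T⟩`. [folklore] -/
private theorem pairing_eq_zero_of_mem_closure {R : Type*} [AddCommGroup R] (P : S.Sel →+ S.Sel →+ R)
    {T : Set V} (hT : T ⊆ S.Sel) {t : V} (ht : t ∈ S.Sel)
    (h0 : ∀ w, ∀ hw : w ∈ T, P ⟨w, hT hw⟩ ⟨t, ht⟩ = 0)
    {w : V} (hw : w ∈ AddSubgroup.closure T) (hwS : w ∈ S.Sel) :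
    P ⟨w, hwS⟩ ⟨t, ht⟩ = 0 := by
  have hle : AddSubgroup.closure T ≤ S.Sel := (AddSubgroup.closure_le _).mpr hT
  revert hwS
  induction hw using AddSubgroup.closure_induction with
  | mem w h => exact fun _ ↦ h0 w h
  | zero => exact fun h ↦ by rw [show (⟨0, h⟩ : S.Sel) = 0 from rfl, map_zero, AddMonoidHom.zero_apply]
  | add w w' hw hw' ih ih' =>
    intro h
    have : (⟨w + w', h⟩ : S.Sel) = ⟨w, hle hw⟩ + ⟨w', hle hw'⟩ := rfl
    rw [this, map_add, AddMonoidHom.add_apply, ih (hle hw), ih' (hle hw'), add_zero]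
  | neg w hw ih =>
    intro h
    rw [show (⟨-w, h⟩ : S.Sel) = -⟨w, hle hw⟩ from rfl, map_neg, AddMonoidHom.neg_apply, ih (hle hw),
      neg_zero]

/-! ### The chain `n_k = ℓ₁ ⋯ ℓ_k` and the invariant (I) -/

/-- **McCallum 1991, proof of Thm. 5.4 — the chain, with invariant (I).** Under the hypotheses of
`sum_expo_le_M₀_of_casselsTate` (see the module docstring), for every `k ≤ K` there is
`n = n_k ∈ S_k` (`k` prime factors) such that the later lifts `s_j`, `j > k`, vanish at every
prime of `n` (McCallum (19)/(23)) and
**(I)** `p^i c(n) ∈ ⟨s_j : k < j ≤ K⟩ ⟹ (M - M₀) + ∑_{j ≤ k} expo s_j ≤ i`.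
[cite: McCallumLMS1991, Thm. 5.4 (proof, (16)–(23)), Prop. 4.7, Lemma 5.3, Prop. 3.1] -/
theorem exists_chain_of_casselsTate {R : Type*} [AddCommGroup R] (P : S.Sel →+ S.Sel →+ R)
    (hCTV : ∀ ℓ m : ℕ, S.Kol ℓ → KolSupp S.Kol (ℓ * m) → ¬ ℓ ∣ m →
      ∀ (j N a b : ℕ) (t : V) (ht : t ∈ S.Sel) (hz : ((S.p : ℤ) ^ j) • S.c (ℓ * m) ∈ S.Sel),
      ((S.p : ℤ) ^ N) • t = 0 → t ∈ S.eig (S.ε * (-1) ^ (ℓ * m).primeFactors.card) →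
      (∀ q ∈ m.primeFactors, t ∈ S.A q) → S.M - S.M₀ ≤ j → N + S.M₀ ≤ S.M → N ≤ j → a + b + 1 = N →
      ((S.p : ℤ) ^ (a + (j - N))) • S.c m ∉ S.A ℓ → ((S.p : ℤ) ^ b) • t ∉ S.A ℓ →
      P ⟨_, hz⟩ ⟨t, ht⟩ ≠ 0)
    (hCeb : ∀ (T : Finset V) (g₁ g₂ : V) (ν : ℤ), (ν = 1 ∨ ν = -1) → g₁ ∈ S.eig ν →
      g₂ ∈ S.eig (-ν) → (∀ t ∈ T, ∃ e : ℤ, (e = 1 ∨ e = -1) ∧ t ∈ S.eig e) → ∀ b : ℕ,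
      ∃ ℓ, b < ℓ ∧ S.Kol ℓ ∧ ∀ g ∈ AddSubgroup.closure (insert g₁ (insert g₂ (T : Set V))),
        g ∈ S.A ℓ ↔ g ∈ AddSubgroup.closure (T : Set V))
    (K : ℕ) (s : ℕ → V) (hsel : ∀ i, s i ∈ S.Sel)
    (hτs : ∀ i ∈ Finset.Ioc 0 K, s i ∈ S.eig (S.ε * (-1) ^ i))
    (hiso : ∀ i ∈ Finset.Ioc 0 K, ∀ i' ∈ Finset.Ioc 0 K, P ⟨s i, hsel i⟩ ⟨s i', hsel i'⟩ = 0)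
    (hind : ∀ (b : ℤ) (a : ℕ → ℤ), b • S.x + ∑ i ∈ Finset.Ioc 0 K, a i • s i = 0 →
      b • S.x = 0 ∧ ∀ i ∈ Finset.Ioc 0 K, a i • s i = 0)
    (hroom : ∀ i ∈ Finset.Ioc 0 K, S.expo (s i) + S.M₀ ≤ S.M) (k : ℕ) (hk : k ≤ K) :
    ∃ n, KolSupp S.Kol n ∧ n.primeFactors.card = k ∧
      (∀ q ∈ n.primeFactors, ∀ i ∈ Finset.Ioc k K, s i ∈ S.A q) ∧
      ∀ i : ℕ, ((S.p : ℤ) ^ i) • S.c n ∈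
          AddSubgroup.closure (((Finset.Ioc k K).image s : Finset V) : Set V) →
        (S.M - S.M₀) + ∑ j ∈ Finset.Ioc 0 k, S.expo (s j) ≤ i := by
  have hp := S.hp
  -- the pools `⟨s_j : k < j ≤ K⟩` lie in `Sel`
  have hpool : ∀ k, (((Finset.Ioc k K).image s : Finset V) : Set V) ⊆ S.Sel := by
    intro k v hv
    rw [Finset.coe_image, Set.mem_image] at hv
    obtain ⟨i, -, rfl⟩ := hv
    exact hsel i
  induction k with
  | zero =>
    refine ⟨1, kolSupp_one _, by simp, by simp, fun i hi ↦ ?_⟩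
    rw [S.c_one, smul_smul, ← pow_add] at hi
    have h0 := S.zsmul_x_eq_zero_of_mem_closure_Ioc hind hi
    rw [S.zsmul_x_eq_zero_iff', ← Nat.cast_pow, ← Nat.cast_pow, Int.natCast_dvd_natCast,
      Nat.pow_dvd_pow_iff_le_right hp.one_lt] at h0
    simp only [Finset.Ioc_self, Finset.sum_empty, add_zero]
    omega
  | succ k ih =>
    obtain ⟨n, hn, hcard, hA, hI⟩ := ih (by omega)
    have hn0 : n ≠ 0 := hn.1.ne_zero
    have hk1 : k + 1 ∈ Finset.Ioc 0 K := by simp only [Finset.mem_Ioc]; omega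
    have hk1' : k + 1 ∈ Finset.Ioc k K := by simp only [Finset.mem_Ioc]; omega
    -- signs: `s_{k+1} ∈ V^{ν}`, `c(n_k) ∈ V^{-ν}`, `ν = ε (-1)^{k+1}`
    set ν : ℤ := S.ε * (-1) ^ (k + 1) with hν
    have hν1 : ν = 1 ∨ ν = -1 := S.sign_pow_cases (k + 1)
    have hτs' : s (k + 1) ∈ S.eig ν := hτs (k + 1) hk1
    have hτc : S.c n ∈ S.eig (-ν) := by
      have h := S.c_eig n hn
      rwa [hcard, show S.ε * (-1) ^ k = -ν by rw [hν, pow_succ]; ring] at h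
    set T : Finset V := (Finset.Ioc (k + 1) K).image s with hT
    have hTτ : ∀ t ∈ T, ∃ e : ℤ, (e = 1 ∨ e = -1) ∧ t ∈ S.eig e := by
      intro t ht
      rw [hT, Finset.mem_image] at ht
      obtain ⟨i, hi, rfl⟩ := ht
      refine ⟨_, S.sign_pow_cases i, hτs i ?_⟩
      simp only [Finset.mem_Ioc] at hi ⊢
      omega
    -- the sub-pool `⟨T⟩ ≤ ⟨s_j : k < j⟩`
    have hTsub : (T : Set V) ⊆ (((Finset.Ioc k K).image s : Finset V) : Set V) := by
      rw [hT, Finset.coe_image, Finset.coe_image]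
      apply Set.image_mono
      intro i hi
      simp only [Finset.coe_Ioc, Set.mem_Ioc] at hi ⊢
      omega
    -- ### the Kolyvagin prime `ℓ = ℓ_{k+1}` (McCallum (21)–(23))
    obtain ⟨ℓ, hℓn, hℓ, hker⟩ := hCeb T (s (k + 1)) (S.c n) ν hν1 hτs' hτc hTτ n
    have hℓp := S.prime_of_kol ℓ hℓ
    have hndvd : ¬ ℓ ∣ n := fun h ↦ by
      have := Nat.le_of_dvd (Nat.pos_of_ne_zero hn0) h
      omega
    have hsupp : KolSupp S.Kol (ℓ * n) := S.kolSupp_mul_of_not_dvd hℓ hn hndvd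
    have hcard' : (ℓ * n).primeFactors.card = k + 1 := by
      rw [card_primeFactors_mul_of_not_dvd hℓp hn0 hndvd, hcard]
    -- membership in `⟨s_{k+1}, c(n), T⟩`
    have hGc : ∀ i : ℕ, ((S.p : ℤ) ^ i) • S.c n ∈
        AddSubgroup.closure (insert (s (k + 1)) (insert (S.c n) (T : Set V))) := fun i ↦
      AddSubgroup.zsmul_mem _
        (AddSubgroup.subset_closure (Set.mem_insert_of_mem _ (Set.mem_insert _ _))) _
    have hGs : ∀ i : ℕ, ((S.p : ℤ) ^ i) • s (k + 1) ∈
        AddSubgroup.closure (insert (s (k + 1)) (insert (S.c n) (T : Set V))) := fun i ↦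
      AddSubgroup.zsmul_mem _ (AddSubgroup.subset_closure (Set.mem_insert _ _)) _
    have hGT : ∀ t ∈ (T : Set V),
        t ∈ AddSubgroup.closure (insert (s (k + 1)) (insert (S.c n) (T : Set V))) := fun t ht ↦
      AddSubgroup.subset_closure (Set.mem_insert_of_mem _ (Set.mem_insert_of_mem _ ht))
    -- Fact B: `p^{i'} c(n)_λ = 0 ⟹ i' ≥ (M - M₀) + ∑_{j ≤ k} N_j` (from (I) at `k`)
    have hB : ∀ i' : ℕ, ((S.p : ℤ) ^ i') • S.c n ∈ S.A ℓ →
        (S.M - S.M₀) + ∑ j ∈ Finset.Ioc 0 k, S.expo (s j) ≤ i' := fun i' hi' ↦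
      hI i' (AddSubgroup.closure_mono hTsub ((hker _ (hGc i')).mp hi'))
    refine ⟨ℓ * n, hsupp, hcard', fun q hq i hi ↦ ?_, fun i hi ↦ ?_⟩
    · -- (19)/(23): the later lifts vanish at the primes of `ℓ n`
      rw [Nat.primeFactors_mul hℓp.ne_zero hn0, Finset.mem_union, hℓp.primeFactors,
        Finset.mem_singleton] at hq
      rcases hq with rfl | hq
      · have hmemT : s i ∈ (T : Set V) := by
          rw [hT, Finset.coe_image]
          exact Set.mem_image_of_mem _ (by simpa using hi)
        exact (hker (s i) (hGT _ hmemT)).mpr (AddSubgroup.subset_closure hmemT)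
      · refine hA q hq i ?_
        simp only [Finset.mem_Ioc] at hi ⊢
        omega
    · -- ### the invariant (I) at `k + 1`
      rw [Finset.sum_Ioc_succ_top (Nat.zero_le k), ← add_assoc]
      have hSel : ((S.p : ℤ) ^ i) • S.c (ℓ * n) ∈ S.Sel :=
        (AddSubgroup.closure_le _).mpr ((hT ▸ hpool (k + 1))) hi
      have hAℓ : ((S.p : ℤ) ^ i) • S.c n ∈ S.A ℓ :=
        (S.c_mem_loc_iff ℓ n hℓ hsupp i).mp ((S.mem_sel_iff _).mp hSel (S.pl ℓ))
      have hB0 := hB i hAℓ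
      by_cases hN : S.expo (s (k + 1)) = 0
      · rw [hN]
        omega
      by_contra hlt
      push Not at hlt
      have hNi : S.expo (s (k + 1)) ≤ i := by
        have := hroom (k + 1) hk1
        omega
      -- (21): `p^{i - N} c(n)_λ ≠ 0`
      have hnot : ((S.p : ℤ) ^ (0 + (i - S.expo (s (k + 1))))) • S.c n ∉ S.A ℓ := by
        intro h
        rw [zero_add] at h
        have := hB _ h
        omega
      -- (22): `s_{k+1}` has full order at `λ`
      have hsfull : ((S.p : ℤ) ^ (S.expo (s (k + 1)) - 1)) • s (k + 1) ∉ S.A ℓ := by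
        intro h
        have hT' := (hker _ (hGs _)).mp h
        exact S.pow_expo_sub_one_zsmul_ne_zero' hN
          (S.zsmul_eq_zero_of_mem_closure_Ioc hind hk1 (hT ▸ hT'))
      have hτsk : s (k + 1) ∈ S.eig (S.ε * (-1) ^ (ℓ * n).primeFactors.card) := by
        rw [hcard']
        exact hτs'
      have hAq : ∀ q ∈ n.primeFactors, s (k + 1) ∈ S.A q := fun q hq ↦ hA q hq (k + 1) hk1'
      have hne := hCTV ℓ n hℓ hsupp hndvd i (S.expo (s (k + 1))) 0 (S.expo (s (k + 1)) - 1)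
        (s (k + 1)) (hsel _) hSel (S.pow_expo_zsmul' _) hτsk hAq (by omega) (hroom (k + 1) hk1) hNi
        (by omega) hnot
        hsfull
      -- isotropy of `⟨T⟩ ∋ p^i c(n_{k+1})` with `s_{k+1}`
      refine hne (S.pairing_eq_zero_of_mem_closure P (hT ▸ hpool (k + 1)) (hsel (k + 1))
        (fun w hw ↦ ?_) hi hSel)
      rw [hT, Finset.coe_image, Set.mem_image] at hw
      obtain ⟨i', hi', rfl⟩ := hw
      refine hiso i' ?_ (k + 1) hk1
      simp only [Finset.coe_Ioc, Set.mem_Ioc, Finset.mem_Ioc] at hi' ⊢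
      omega

/-! ### Kolyvagin's inequality `∑ Nᵢ ≤ M₀` -/

/-- **Kolyvagin's bound on the order of `Ш(E/K)_{p^∞}` (McCallum 1991, §1 Theorem with Thm. 5.4
"≤" and Cor. 5.6), telescope form.** Let `S` be Kolyvagin's descent data modulo `p^M` and let
`s₁, …, s_K ∈ Sel = S_{p^M}(E/K)` be `τ`-eigenclasses, `τ sᵢ = ε(-1)ⁱ sᵢ`, independent together
with `x` (so that their images in `Ш(E/K)_{p^M} = Sel/ℤx` span `⊕ ⟨s̄ᵢ⟩` with `ord s̄ᵢ = ord sᵢ`),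
pairwise isotropic for the bi-additive pairing `P` on `Sel` (the Cassels–Tate pairing pulled back
to `Sel`), with `ord sᵢ · p^{M₀} ∣ p^M`. Assume McCallum's Prop. 4.7 / Lemma 5.3 / Prop. 4.4 in
order language (`hCTV`, the non-vanishing of the Cassels–Tate value `⟨d_{M-j}(ℓm), d⟩` at the one
surviving place `λ`) and Prop. 3.1 in kernel form (`hCeb`). Then
**`∑ᵢ ord_p(ord sᵢ) ≤ M₀ = ord_p [E(K) : ℤ y_K]`** — for the lifts of a maximal isotropic
`D = ⊕ Dᵢ` of `Ш(E/K)_{p^∞}` (McCallum p. 288) this is `∑ Nᵢ ≤ M₀`, i.e.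
`#Ш(E/K)_{p^∞} = (#D)² ≤ p^{2M₀}`. The proof is McCallum's induction (Thm. 5.4) run with the
invariant (I) of `exists_chain_of_casselsTate` instead of the optimality (20), so that Prop. 5.2
is not needed for the inequality.
[cite: McCallumLMS1991, §1 Theorem; Thm. 5.4 (proof), Cor. 5.6; Prop. 3.1, Prop. 4.7, Lemma 5.3] -/
theorem sum_expo_le_M₀_of_casselsTate {R : Type*} [AddCommGroup R] (P : S.Sel →+ S.Sel →+ R)
    (hCTV : ∀ ℓ m : ℕ, S.Kol ℓ → KolSupp S.Kol (ℓ * m) → ¬ ℓ ∣ m →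
      ∀ (j N a b : ℕ) (t : V) (ht : t ∈ S.Sel) (hz : ((S.p : ℤ) ^ j) • S.c (ℓ * m) ∈ S.Sel),
      ((S.p : ℤ) ^ N) • t = 0 → t ∈ S.eig (S.ε * (-1) ^ (ℓ * m).primeFactors.card) →
      (∀ q ∈ m.primeFactors, t ∈ S.A q) → S.M - S.M₀ ≤ j → N + S.M₀ ≤ S.M → N ≤ j → a + b + 1 = N →
      ((S.p : ℤ) ^ (a + (j - N))) • S.c m ∉ S.A ℓ → ((S.p : ℤ) ^ b) • t ∉ S.A ℓ →
      P ⟨_, hz⟩ ⟨t, ht⟩ ≠ 0)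
    (hCeb : ∀ (T : Finset V) (g₁ g₂ : V) (ν : ℤ), (ν = 1 ∨ ν = -1) → g₁ ∈ S.eig ν →
      g₂ ∈ S.eig (-ν) → (∀ t ∈ T, ∃ e : ℤ, (e = 1 ∨ e = -1) ∧ t ∈ S.eig e) → ∀ b : ℕ,
      ∃ ℓ, b < ℓ ∧ S.Kol ℓ ∧ ∀ g ∈ AddSubgroup.closure (insert g₁ (insert g₂ (T : Set V))),
        g ∈ S.A ℓ ↔ g ∈ AddSubgroup.closure (T : Set V))
    (K : ℕ) (s : ℕ → V) (hsel : ∀ i, s i ∈ S.Sel)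
    (hτs : ∀ i ∈ Finset.Ioc 0 K, s i ∈ S.eig (S.ε * (-1) ^ i))
    (hiso : ∀ i ∈ Finset.Ioc 0 K, ∀ i' ∈ Finset.Ioc 0 K, P ⟨s i, hsel i⟩ ⟨s i', hsel i'⟩ = 0)
    (hind : ∀ (b : ℤ) (a : ℕ → ℤ), b • S.x + ∑ i ∈ Finset.Ioc 0 K, a i • s i = 0 →
      b • S.x = 0 ∧ ∀ i ∈ Finset.Ioc 0 K, a i • s i = 0)
    (hroom : ∀ i ∈ Finset.Ioc 0 K, S.expo (s i) + S.M₀ ≤ S.M) :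
    ∑ i ∈ Finset.Ioc 0 K, S.expo (s i) ≤ S.M₀ := by
  obtain ⟨n, -, -, -, hI⟩ :=
    S.exists_chain_of_casselsTate P hCTV hCeb K s hsel hτs hiso hind hroom K le_rfl
  have := hI S.M (by rw [S.torsion]; exact zero_mem _)
  omega

end SplitHypothesesM

end KolyvaginDescent

end Literature.NumberTheory.EllipticCurves
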